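import Literature.Geometry.Lorentzian.HypersurfaceNaturality
import Literature.Geometry.Lorentzian.RiemannianVolumeIsometry
import Literature.Geometry.Lorentzian.IsometryProofs
import Literature.Geometry.Riemannian.RiemannianDistance
import HarnessLib

/-!
# Isometries map geodesics to geodesics; geodesic completeness is an isometry invariant

Sixth layer (transport, part C) of the proof programme of the named fact
`Literature.Geometry.Riemannian.Carron1998_ends_le_rank_l2HarmonicOneForms`
(`L2HarmonicOneFormsSobolev.lean`): for a `C^∞` diffeomorphism `Φ : N → M` which is an isometry
`(N, hN) → (M, h)` of smooth Riemannian metrics (Mathlib `ContMDiffRiemannianMetric`s read through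
`PseudoRiemannianMetric.ofRiemannian`),

* `IsIsometry.isGeodesic_symm_comp` — if `γ` is a geodesic of `(M, h)` then `Φ⁻¹ ∘ γ` is a
  geodesic of `(N, hN)`: its tangent lift is `TΦ⁻¹ ∘ (tangent lift of γ)`, and
  `dΦ (D^{hN}(Φ⁻¹∘γ)'/dt) = D^{h} γ'/dt = 0` by the naturality of the induced covariant derivative
  along curves (`mfderiv_covariantDerivAlong_comap`, O'Neill 1983, Ch. 3, Prop. 3.59 with
  Prop. 3.18);
* `IsIsometry.isGeodesicallyComplete` — **geodesic completeness transports along isometries**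
  (O'Neill 1983, Ch. 3, Cor. 3.61 ff.: isometries preserve geodesics, hence completeness).

Everything is proved; no definitions, no named facts (D-0026).

## References

* B. O'Neill, *Semi-Riemannian geometry*, Academic Press 1983, Ch. 3, Prop. 3.18, Prop. 3.59,
  Cor. 3.61, Def. 3.19 ff. (completeness). [`ONeill1983`]
-/

noncomputable section

open Bundle Set Function Filter Topology Manifold
open scoped Manifold ContDiff

namespace Literature.Geometry.Riemannian

open Literature.Geometry.Lorentzian
open Literature.Geometry.Lorentzian.PseudoRiemannianMetric

variable {E : Type*} [NormedAddCommGroup E] [NormedSpace ℝ E] {H : Type*} [TopologicalSpace H]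
  {I : ModelWithCorners ℝ E H} {M : Type*} [TopologicalSpace M] [ChartedSpace H M]
  [IsManifold I ∞ M]
  {E' : Type*} [NormedAddCommGroup E'] [NormedSpace ℝ E'] {H' : Type*} [TopologicalSpace H']
  {I' : ModelWithCorners ℝ E' H'} {N : Type*} [TopologicalSpace N] [ChartedSpace H' N]
  [IsManifold I' ∞ N]
  [FiniteDimensional ℝ E] [FiniteDimensional ℝ E']
  {Φ : Diffeomorph I' I N M ∞}
  {hN : ContMDiffRiemannianMetric I' ∞ E' (TangentSpace I' : N → Type _)}
  {h : ContMDiffRiemannianMetric I ∞ E (TangentSpace I : M → Type _)}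

/-! ### Curves and their tangent lifts under a diffeomorphism -/

omit [IsManifold I ∞ M] [IsManifold I' ∞ N] [FiniteDimensional ℝ E] [FiniteDimensional ℝ E'] in
/-- Chain rule for velocities: `(f ∘ γ)'(t) = df_{γ t}(γ'(t))`. [folklore] -/
private theorem velocity_comp' {f : M → N} {γ : ℝ → M} {t : ℝ}
    (hf : MDifferentiableAt I I' f (γ t)) (hγ : MDifferentiableAt 𝓘(ℝ, ℝ) I γ t) :
    velocity I' (f ∘ γ) t = mfderiv I I' f (γ t) (velocity I γ t) := by
  simp only [velocity]
  rw [mfderiv_comp t hf hγ]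
  rfl

omit [IsManifold I ∞ M] [IsManifold I' ∞ N] [FiniteDimensional ℝ E] [FiniteDimensional ℝ E'] in
/-- The tangent lift of `f ∘ γ` is `Tf ∘ (tangent lift of γ)` wherever `γ` is differentiable.
[folklore] -/
private theorem tangentLift_comp' {f : M → N} (hf : ContMDiff I I' ∞ f) {γ : ℝ → M} {t : ℝ}
    (hγ : MDifferentiableAt 𝓘(ℝ, ℝ) I γ t) :
    tangentLift I' (f ∘ γ) t = tangentMap I I' f (tangentLift I γ t) := by
  simp only [tangentLift, tangentMap, Function.comp_apply]
  rw [velocity_comp' ((hf _).mdifferentiableAt (by simp)) hγ]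
  rfl

omit [FiniteDimensional ℝ E] [FiniteDimensional ℝ E'] in
/-- If the tangent lift of `γ` is differentiable at `t`, so is the tangent lift of `f ∘ γ` for a
smooth `f` (everywhere-differentiable `γ`). [folklore] -/
private theorem mdifferentiableAt_tangentLift_comp' {f : M → N} (hf : ContMDiff I I' ∞ f)
    {γ : ℝ → M} (hγd : ∀ t, MDifferentiableAt 𝓘(ℝ, ℝ) I γ t) {t : ℝ}
    (hγ : MDifferentiableAt 𝓘(ℝ, ℝ) I.tangent (tangentLift I γ) t) :
    MDifferentiableAt 𝓘(ℝ, ℝ) I'.tangent (tangentLift I' (f ∘ γ)) t := by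
  have heq : tangentLift I' (f ∘ γ) = tangentMap I I' f ∘ tangentLift I γ :=
    funext fun s ↦ tangentLift_comp' hf (hγd s)
  rw [heq]
  have h2 : (1 : ℕ∞ω) + 1 ≤ ∞ := by
    rw [one_add_one_eq_two]; exact WithTop.coe_le_coe.mpr le_top
  exact ((hf.contMDiff_tangentMap h2 _).mdifferentiableAt one_ne_zero).comp t hγ

/-- Congruence of the covariant derivative along curves in both the curve and the field (the
tangent spaces of Mathlib's tangent bundle being the constant family `E`). [folklore] -/
private theorem covariantDerivAlong_congr'
    (cov : CovariantDerivative I E (TangentSpace I : M → Type _)) {γ₁ γ₂ : ℝ → M} (hγ : γ₁ = γ₂)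
    {W₁ : Π t : ℝ, TangentSpace I (γ₁ t)} {W₂ : Π t : ℝ, TangentSpace I (γ₂ t)}
    (hW : ∀ t, W₁ t = W₂ t) (t₀ : ℝ) :
    covariantDerivAlong cov γ₁ W₁ t₀ = covariantDerivAlong cov γ₂ W₂ t₀ := by
  subst hγ
  have : W₁ = W₂ := funext hW
  subst this
  rfl

/-! ### Geodesics under isometries -/

/-- An isometry identifies the source metric with the pullback of the target metric (local copy
of `IsIsometry.eq_comap`). [cite: ONeill1983, Ch. 3, Def. 3.4 (p. 58)] -/
private theorem eq_comap' (hΦ : IsIsometry (ofRiemannian hN) (ofRiemannian h) Φ)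
    (hdim : Module.finrank ℝ E' = Module.finrank ℝ E) :
    ofRiemannian hN = (ofRiemannian h).comap contMDiff_pullbackBilin_holds Φ
      (Φ.contMDiff.of_le (le_of_eq (by rfl)))
      (fun y ↦ (Φ.mfderivToContinuousLinearEquiv (by simp) y).injective) hdim := by
  ext y v w
  rw [val_comap, ← hΦ y]

/-- **Isometries map geodesics to geodesics.** If `Φ : (N, hN) → (M, h)` is an isometry and `γ`
is a geodesic of `(M, h)` (O'Neill's definition: differentiable tangent lift and `D γ'/dt = 0`),
then `Φ⁻¹ ∘ γ` is a geodesic of `(N, hN)`: `dΦ (D^{hN} (Φ⁻¹∘γ)'/dt) = D^h γ'/dt = 0` by the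
naturality of the induced covariant derivative (`mfderiv_covariantDerivAlong_comap`) and `dΦ` is
injective. O'Neill 1983, Ch. 3, Prop. 3.59 and Cor. 3.61. [cite: ONeill1983, Ch. 3, Prop. 3.59] -/
theorem _root_.Literature.Geometry.Lorentzian.PseudoRiemannianMetric.IsIsometry.isGeodesic_symm_comp
    (hΦ : IsIsometry (ofRiemannian hN) (ofRiemannian h) Φ)
    (hdim : Module.finrank ℝ E' = Module.finrank ℝ E) [(ofRiemannian hN).HasLeviCivita]
    [(ofRiemannian h).HasLeviCivita] {γ : ℝ → M}
    (hγ : IsGeodesic (ofRiemannian h).leviCivita γ) :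
    IsGeodesic (ofRiemannian hN).leviCivita (Φ.symm ∘ γ) := by
  haveI : CompleteSpace E := FiniteDimensional.complete ℝ E
  haveI : CompleteSpace E' := FiniteDimensional.complete ℝ E'
  set γN : ℝ → N := Φ.symm ∘ γ with hγN
  have hγd : ∀ t, MDifferentiableAt 𝓘(ℝ, ℝ) I γ t := fun t ↦
    mdifferentiableAt_of_mdifferentiableAt_lift (hγ.1 t (mem_univ t))
  have hlift : ∀ t, MDifferentiableAt 𝓘(ℝ, ℝ) I'.tangent (tangentLift I' γN) t := fun t ↦
    mdifferentiableAt_tangentLift_comp' Φ.symm.contMDiff hγd (hγ.1 t (mem_univ t))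
  have hγNd : ∀ t, MDifferentiableAt 𝓘(ℝ, ℝ) I' γN t := fun t ↦
    mdifferentiableAt_of_mdifferentiableAt_lift (hlift t)
  have hΦγN : (Φ : N → M) ∘ γN = γ := funext fun t ↦ by simp [hγN]
  have hvel : ∀ t, mfderiv I' I Φ (γN t) (velocity I' γN t) = velocity I γ t := by
    intro t
    rw [← velocity_comp' ((Φ.contMDiff _).mdifferentiableAt (by simp)) (hγNd t)]
    exact congrArg (fun f : ℝ → M ↦ (mfderiv 𝓘(ℝ, ℝ) I f t (1 : ℝ) : E)) hΦγN
  refine ⟨fun t _ ↦ hlift t, fun t _ ↦ ?_⟩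
  -- naturality of `D/dt`, for the pullback metric `Φ^* h = hN`
  have key : ∀ (g' : PseudoRiemannianMetric I' ∞ E' (TangentSpace I' : N → Type _))
      [g'.HasLeviCivita], g' = (ofRiemannian h).comap contMDiff_pullbackBilin_holds Φ
        (Φ.contMDiff.of_le (le_of_eq (by rfl)))
        (fun y ↦ (Φ.mfderivToContinuousLinearEquiv (by simp) y).injective) hdim →
      mfderiv I' I Φ (γN t) (covariantDerivAlong g'.leviCivita γN (fun t ↦ velocity I' γN t) t) =
        covariantDerivAlong (ofRiemannian h).leviCivita ((Φ : N → M) ∘ γN)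
          (fun t ↦ mfderiv I' I Φ (γN t) (velocity I' γN t)) t := by
    intro g' _ hg'
    subst hg'
    exact mfderiv_covariantDerivAlong_comap (ofRiemannian h) contMDiff_pullbackBilin_holds
      (Φ.contMDiff.of_le (le_of_eq (by rfl)))
      (fun y ↦ (Φ.mfderivToContinuousLinearEquiv (by simp) y).injective) hdim (hlift t)
  have h1 := key _ (eq_comap' hΦ hdim)
  rw [covariantDerivAlong_congr' (ofRiemannian h).leviCivita hΦγN hvel t, hγ.2 t (mem_univ t)] at h1
  exact (Φ.mfderivToContinuousLinearEquiv (by simp) (γN t)).injective (h1.trans (map_zero _).symm)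

/-- **Geodesic completeness is an isometry invariant**: if `Φ : (N, hN) → (M, h)` is an isometry
and `(M, h)` is geodesically complete, so is `(N, hN)` (the geodesic of `N` with initial data
`(x, v)` is `Φ⁻¹ ∘ γ` for the complete geodesic `γ` of `M` with data `(Φ x, dΦ v)`).
O'Neill 1983, Ch. 3, Cor. 3.61 with Def. 3.19 ff. [cite: ONeill1983, Ch. 3, Prop. 3.59] -/
theorem _root_.Literature.Geometry.Lorentzian.PseudoRiemannianMetric.IsIsometry.isGeodesicallyComplete
    (hΦ : IsIsometry (ofRiemannian hN) (ofRiemannian h) Φ)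
    (hdim : Module.finrank ℝ E' = Module.finrank ℝ E) [(ofRiemannian hN).HasLeviCivita]
    [(ofRiemannian h).HasLeviCivita]
    (hc : IsGeodesicallyComplete (ofRiemannian h).leviCivita) :
    IsGeodesicallyComplete (ofRiemannian hN).leviCivita := by
  intro x v
  set A := Φ.mfderivToContinuousLinearEquiv (by simp) x with hA
  obtain ⟨γ, hγ, h0, hv0⟩ := hc (Φ x) (A v)
  refine ⟨Φ.symm ∘ γ, hΦ.isGeodesic_symm_comp hdim hγ, by simp [h0], ?_⟩
  have hγd : MDifferentiableAt 𝓘(ℝ, ℝ) I γ 0 :=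
    mdifferentiableAt_of_mdifferentiableAt_lift (hγ.1 0 (mem_univ 0))
  have hγNd : MDifferentiableAt 𝓘(ℝ, ℝ) I' (Φ.symm ∘ γ) 0 :=
    ((Φ.symm.contMDiff _).mdifferentiableAt (by simp)).comp 0 hγd
  have hΦγ : (Φ : N → M) ∘ (Φ.symm ∘ γ) = γ := funext fun t ↦ by simp
  have h1 : mfderiv I' I Φ ((Φ.symm ∘ γ) 0) (velocity I' (Φ.symm ∘ γ) 0) = velocity I γ 0 := by
    rw [← velocity_comp' ((Φ.contMDiff _).mdifferentiableAt (by simp)) hγNd]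
    exact congrArg (fun f : ℝ → M ↦ (mfderiv 𝓘(ℝ, ℝ) I f 0 (1 : ℝ) : E)) hΦγ
  have hx : (Φ.symm ∘ γ) 0 = x := by simp [h0]
  rw [hv0] at h1
  subst hx
  exact A.injective h1

end Literature.Geometry.Riemannian

end
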